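/-
Origin: expansion seat `planner-pub-hodgecm-prl2-g7-0`, handover #1 v7 2026-08-18T13:05Z md5 10272258 (doc-only over v4 0b7dd337 via v5 1131e5a0 / v6 ad05dfb2: docstrings cite the typed `UpUmnTheta.Adams_Prop_6_6`, title + headline list mention Part D, BMM arXiv/Acta locator concordance; 1138 l.; v4 SUPERSEDED b3d1f4e5, CODE CHANGE purely additive +274/ -0: Part D (CG) reduced — SeesawDatum.exists_glue (Landherr), ThetaModel.contextGlue_of_bmm, BMMGlueFace/PerL, (`HOME/pub-hodgecm-prl2-g7/lean/Prl2g7/ThetaSpanFromBMM.lean`, md5 10272258, 1138 lines);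
landed by the gen-8 packager in gate run 30 as `HodgeCM/StubTree/ThetaSpanFromBMM.lean` (verbatim).
-/
/-
Copyright (c) 2026 the pub-hodgecm formalisation cell (harness21).  New file, not vendored.
Origin: HOME/pub-hodgecm-prl2-g7/lean/Prl2g7/ThetaSpanFromBMM.lean — EXPANSION prover a-2 (strategy 2: "REDUCE,
don't construct"), lineage prl2, generation 7, session planner-pub-hodgecm-prl2-g7-0, 2026-08-18.  Suggested target
`HodgeCM/StubTree/ThetaSpanFromBMM.lean` (NEW additive leaf: imports landed tree modules only; nothing imports it).
-/
import Summits.HodgeConjecture.HodgeCM.StubTree.ObstructionFromTheta_2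
import Summits.HodgeConjecture.HodgeCM.Literature.ThetaLiftExhaustion
import Summits.HodgeConjecture.HodgeCM.Proofs.SeesawConstruction_2
import Summits.HodgeConjecture.HodgeCM.Proofs.LandherrNecessity
import Summits.HodgeConjecture.HodgeCM.Literature.NormTheoremHolds

/-!
# The theta span (TS) from Bergeron–Millson–Moeglin Cor 7.9, BY NAME, and the context glue (CG) from Landherr — strategy 2, generation 7

Generation 6 (`HodgeCM.StubTree.ObstructionFromTheta`, landed run 28) isolated THE RESIDUAL of the "REDUCE" lineage
as `ThetaSpanFace T` / `ThetaSpanPerL T` = (TS) `ThetaModel.ThetaSpan` ∧ (CG) `ThetaModel.ContextGlue`: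

  (TS)  `U_{Ψ_i}(Γ) ⊆ span ⋃_{c good, (c.K,c.Ψ,c.σ) = (K,Ψ,σ)} Θ_i(c, Γ)`   (`i = 0, 1`, every level `Γ`).

This file REDUCES (TS) one step further, to the printed exhaustion theorem it was always meant to rest on —
[BMM16] N. Bergeron, J. Millson, C. Moeglin, *The Hodge conjecture and arithmetic quotients of complex balls*,
Acta Math. 216 (2016) 1–125, **Corollary 7.9** of arXiv:1306.1515v3 (= **Corollary 7.3, p. 66** of the Acta version; arXiv Thm 7.8 =
Acta Thm 7.2, p. 65 — concordance read by the cf-rogawski seat, STATUS 11:44:00Z; held text `paper:arxiv-1306.1515`, chunk p0034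
L43–47; printed caveat §1.9, chunk p0006: the results rest on the stabilisation of the (twisted) trace formula,
carried by the typed statement's own docstring): "Let `S` be any
connected component of `S(K)` and let `a` and `b` be integers such that `3(a+b)+|a−b| < 2m`. Then `H^{b×q, a×q}(S, ℂ)`
is generated by classes of theta lifts from unitary groups of skew-hermitian spaces `W` of signature `(a,b)` at
infinity" — typed VERBATIM in this package as the named `Prop` `HodgeCM.Literature.BMM.BMMSpectrum.Cor79` (file
`HodgeCM/Literature/ThetaLiftExhaustion.lean`, cf-rogawski seat, landed run 28), and CONSUMED HERE BY NAME: the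
hypothesis is `∀ Γ, (BD.X Γ).Cor79` for the spectra `BD.X Γ` of the dictionary datum, in degree one
(`a + b = 1`, where the printed bound reads `m ≥ 3`: `BMMSpectrum.degreeBound_of_add_eq_one`).

## The reduction (all theorems below are kernel-checked; classes label the HYPOTHESES)

  (TS) for `(K, Ψ, σ)` at `(L, ι₁, V)`
    ⇐  [P]      `∀ Γ, (BD.X Γ).Cor79`                       — [BMM16] Cor 7.9, by name;
     ∧ [P-IF]   `BD.Standard T`                              — the typed DICTIONARY SEAMS between the universe's
                                                               `H^{1,0}(P_Γ)` and BMM's `H^{b×q,a×q}(S, ℂ)` (below);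
     ∧ [M]      `U.UisoDisjoint V`                           — distinct isotypic pieces `U_{(K,Ψ,σ)}(Γ)` are
                                                               linearly disjoint (CM blocks of `H^{1,0}(Alb P_Γ)`);
     ∧ [P-IF]   `BD.Homogeneous`                             — a theta one-form class from ONE hermitian line lies
                                                               in ONE isotypic piece ([Liu21] Thm 4.18: the
                                                               `ω(μ,ε,χ)`-part of `H¹` is pulled back from ONE `A_μ`);
     ∧ [DESIGN] `BD.ThetaOfLine T`                           — model reading of the primitive `T.Theta`;
     ∧ [THE OBSTRUCTION] `BD.SignForcing T`                  — CONVERSE SIGN-TYPING: a line `⟨a⟩` whose theta lift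
                                                               has a non-zero `U_Ψ`-component has the `Ψ`-forced
                                                               signs (`ThetaModel.reqPos`); Part C splits it as
                                                               `TypeMatch` [P-IF ∘ M] ∧ `SignMatch` [P-IF], each a
                                                               READING of printed statements (below) — it is an
                                                               untyped READING, not a theorem missing from print;
     ∧ [KERNEL] `exists_seesawDatum_of_signs_fix`            — Def 3.2's seesaw datum with ONE LINE PRESCRIBED
                                                               (proved here: `SeesawConstruction` + a swap);
     ∧ [KERNEL] a good context for `(K,Ψ,σ)` exists          — `ThetaModel.exists_seesawDatum_constructed`
                                                               (from the DESIGN facts `Design_kappaConj`,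
                                                               `Design_frameSignConj`, as in strategy 1).

Proof of (TS) (`ThetaModel.uiso_le_span_theta`): `ω ∈ U_{Ψ_i}(Γ) ⊆ H^{1,0}(P_Γ)`; pull back to the neat level
`fine Γ`, realise in BMM's `H^{b×q,a×q}(S)` (seam `h10_le`), apply Cor 7.9, come back through `theta_sub`/`real_inj`:
`ω` is a finite combination `Σ c_θ θ` of theta one-form classes from lines (`BMMDict.h10_le_span_allTheta`, with the
descent seam for the non-neat level).  Split the sum into the `θ ∈ U_{Ψ_i}` and the `θ ∉ U_{Ψ_i}`; by `Homogeneous`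
each of the latter lies in ANOTHER piece, so their sum lies in `U_{Ψ_i} ∩ Σ(other pieces) = 0` (`UisoDisjoint`);
hence `ω = Σ_{θ ∈ U_{Ψ_i}} c_θ θ`.  A non-zero theta class `θ ∈ U_{Ψ_i}` from the line `⟨a⟩` forces the signs of `a`
(`SignForcing`); the KERNEL completion puts `a` in slot `i` of a forced-sign seesaw datum `D`
(`BMMDict.exists_goodCtx_of_line`), and `ThetaOfLine` gives `θ ∈ Θ_i(⟨K,Ψ,σ,D⟩, Γ)`.  So forward typing
("a theta lift of type `Ψ_i` lies in `U_{Ψ_i}`", PerL Lemma 3.3(a) first half = the tree's `Open_thetaSub`) is NOT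
used for (TS): isotypic projection replaces it; what (TS) irreducibly needs from the Albanese/CM-typing dictionary is
the CONVERSE at the level of SIGNS — `SignForcing` — which is therefore flagged as THE OBSTRUCTION of this lineage
(generation 7).  ITS PRINT CONTENT IS COMPLETE AS INGREDIENTS (Part C, `BMMDict.signForcing_of_match`:
`SignForcing ⇐ TypeMatch ∧ SignMatch`, kernel): (i) `TypeMatch` — a non-zero theta one-form class lifted from `⟨a⟩`
with splitting characters of `L`-type `Φ` that lies in `U_{(K,Ψ,ι₁∘j)}(Γ)` has `κ(τ) ∈ Ψ ⟺ τ ∈ Φ` at every `τ`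
= [Liu21] Yifeng Liu, *Fourier–Jacobi cycles and arithmetic relative trace formula*, Camb. J. Math. 9 (2021) 1–147
(arXiv:2102.11518), §4.2 **Thm 4.18 + Cor 4.20 with Def 4.5** (the `ω(μ,ε,χ)`-isotypic part of
`H¹_{B,τ'}(A_K, ℂ)` is `Hom_E(A_K, A_μ)^* α`, `A_μ` the CM abelian variety of `μ`, its type fixed by the determinant
condition of Def 4.5) — typed VERBATIM in this package as `HodgeCM.Literature.Theta.LiuAlbaneseDatum.Thm418_2` /
`.Cor420` / `.Prop413` (file `HodgeCM/Literature/AlbaneseUnitaryShimura.lean`) and READ in the model exactly as the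
tree's PRINT-INTERFACE fact `ThetaModel.Fact_thetaAlbanese` (file `HodgeCM/PerL34/ThetaSubOfLiu.lean`, readings
R1–R4; R3 = the sign-exact type match, closed as print-derived, GAPS pv04g3-C1/C3) of which `TypeMatch` is the
CONVERSE TWIN, composed with the MODEL fact that two CM data whose pieces share a non-zero vector define the same
block (`UisoDisjoint` gives equality of the pieces; the block determines simple factor and eigencharacter) and the
DESIGN meaning of `κ`; (ii) `SignMatch` — a non-zero holomorphic theta one-form class from `⟨a⟩` with splitting type
`Φ` has, at every `τ`, the sign `frameSign τ` if `τ ∈ Φ` and its negation otherwise = the archimedean theta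
correspondence: at the compact places the trivial `U(3)`-type occurs in the Fock model of `(U(1), U(3))` iff the
sign of the line matches the member of `Φ` above the place (Kashiwara–Vergne, Invent. Math. 44 (1978); J. Adams,
*The theta correspondence over ℝ*, World Sci. 2007, §6 Prop. 6.6 — BOTH typed VERBATIM in
`HodgeCM/Literature/CohomologicalIsolation.lean`: Howe duality for compact pairs `CompactDualPairFock.Adams_Thm_6_3`
and the explicit correspondence `HodgeCM.Literature.UpUmnTheta.Adams_Prop_6_6` for every `(U(p), U(m,n))` — the
compact pair here is its instance `(p; m, n) = (1; 3, 0)` (`Param 1 3 0` forces `ℓ = 0`, `k ∈ {0,1}`: the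
`U(1)`-character of Adams-weight `t + 3/2` pairs with `Sym^t ⊗ det^{1/2}`; vacuum `UpUmnTheta.vacuum_corr`; mind the
inverse-character convention `UpUmnTheta.dualShift_tauWt_one_two_one`, GAPS cfmm3-N1), citable BY NAME as
`(h : D.Adams_Prop_6_6)` once the dictionary from `lineTheta` data to `UpUmnTheta` parameters is typed — not done in
this file), at `ι₁` holomorphic one-forms come from lines of the holomorphic signature ([BMM16] §5, §7:
the special Schwartz class of bidegree `(bq, aq)` is attached to signature `(a,b)`; Gelbart–Rogawski 1991 §3), which
is [Liu21] **Def 4.12**'s admissibility clause "`τ'(e)` has negative imaginary part for every `τ' ∈ Φ_μ`" made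
exact place by place, composed with the DESIGN meaning of `frameSign`.  So NO conjunct of the reduction is
mathematically absent from print; what is absent is ONE verbatim printed statement of the converse sign-typing over
arbitrary lines — THE OBSTRUCTION is an untyped READING (two P-IF composites of the standing of N12a's
`Fact_thetaAlbanese`), and typing it inside the package (a `LiuAlbaneseDatum`-valued dictionary on `lineTheta`) is
the successor's task, not a literature want.  (Generation 6 and v1/v2 of this file said "no verbatim printed
statement in PerL's generality (`L₀ ≠ ℚ`) found" for the Albanese identification: SUPERSEDED — [Liu21] §4.2 is
that statement, for every CM extension `E/F` in the Compact Case, and is typed in the tree; the want acq-07635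
[BR94] filed on that remark is not needed for (TS).)  PerL v5 states the forward half as Lemma 3.3(a) (tex
ll. 280–284) citing the prior programme's [Y1neg, Lemmas 3.1, 3.2, 4.1, 4.2] — under adjudication, not citable here.

## The dictionary datum `BMMDict` and its seams `BMMDict.Standard` (P-IF unless stated)

BMM's setting ([BMM16] §6.1–6.8, chunks p0029–p0031; §1.5–1.6, chunk p0005 L1–45): `E/F` CM, `V` anisotropic
hermitian of signature `(p,q) = (2,1)` at one real place and definite at the others — exactly PerL's `V`
(`HermSpace3 L ι₁`, `d = [L₀:ℚ] ≥ 3`), `m = 3`; `S(K)` the Shimura variety of `G = GU(V)` (equivalently, for our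
purpose, its connected components `S = Γ_S \ B²`) at a NEAT level `K`; for `q = 1`, `SH• = H•` (p0005 L34) and
`H^{1,0}(S) ⊕ H^{0,1}(S) = H^{1×q,0×q} ⊕ H^{0×q,1×q}` (§1.5; body convention `b×q, a×q`, p0005 L34 footnote).
Fields of `BD : U.BMMDict V` (DATA, `T`-free):
* `lineTheta Γ a Φ` — the set of holomorphic theta one-form classes on `P_Γ` lifted from the hermitian LINE
  `W = (L, a x ȳ)` (`a ∈ L₀^×`) with a splitting character `μ` of `L`-TYPE `Φ` (`μ‖·‖^{-1/2}` algebraic of infinity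
  type `−Σ_{ρ∈Φ} ρ`, [Liu21] Def 4.3 `Φ_μ`; ALL such `μ`, ALL automorphic characters of `U(W) = U(1)`, all
  `K_Γ`-invariant Schwartz data); `line Γ a = ⋃_Φ lineTheta Γ a Φ`, `allTheta Γ = ⋃_a line Γ a`;
* `fine Γ ≤ Γ` — a neat normal sublevel; `X Γ : BMMSpectrum` — BMM's objects at (a `GU`-level over) `fine Γ`,
  `comp Γ` — the component carrying `P_{fine Γ}`, `real Γ : H¹(P_{fine Γ}, ℂ) →ₗ H•(S, ℂ)` — the realisation;
* `a b : ℕ` with `a + b = 1` — WHICH of `H^{1×q,0×q}`, `H^{0×q,1×q}` is `H^{1,0}` is left to the datum (the seams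
  below are stated for the pair `(a,b)`; the intended value is the one making `h10_le` true), so no sign
  convention of [BMM16] §1.5 vs. its body is hard-wired.
Seams (`BD.Standard T`): `m_eq` (`m = 3`) [DEF]; `hab` [DEF]; `line_real` (only lines `a ∈ L₀^×`, `a ≠ 0` carry theta
classes) [DEF]; `real_inj` + `h10_le` (`real` is injective and maps `H^{1,0}(P_{fine Γ})` into `H^{b×q,a×q}(S)`)
[P-IF: `S ⊇ P_{fine Γ}` as a component / finite cover and Hodge theory is functorial — Matsushima–Murakami,
Borel–Wallach VII 3.2 (typed `HodgeCM.Literature.CocompactSpectrumHodge.MatsushimaFormulaHodge`), [BMM16] (6.5)–(6.7)];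
`theta_sub` (BMM's "classes of theta lifts from `U(W)`, `W` of signature `(a,b)` at infinity, `dim W = 1`"
are realisations of elements of `allTheta (fine Γ)`) [P-IF: [BMM16] arXiv Def 7.5 + §7.7 (= Acta Def 7.1 p. 64, §7.5
p. 65; concordance cf-rogawski / cf-matsushima-murakami 13:00:44Z) "image of the `ψ`-theta correspondence" = global theta lifts `θ(φ, χ')` (Howe, Kudla; Gelbart–Rogawski 1991 §2), read on the component];
`descent` (if the pull-back of `ω ∈ H¹(P_Γ)` to `P_{fine Γ}` is a combination of theta classes, so is `ω` at level
`Γ`) [MODEL: transfer `tr ∘ π^* = deg · id` for the finite (orbifold) cover `P_{fine Γ} → P_Γ` (Hatcher Prop. 3G.1)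
and the average of a theta form over `Γ/fine Γ` is the theta form of the averaged Schwartz datum].

Model-soundness of the MODEL-class hypotheses (intended universe: Betti cohomology of smooth projective varieties,
`Uiso` = span of pull-backs `F^*α`, `F : P_Γ → A_{(K,Ψ)}`, `α` holomorphic `σ`-eigen — `HodgeCM.Universe.Uiso`):
a non-zero `U.Uiso Γ K Ψ σ` is the block `I_{B(Ψ), σ|K₁}` of `H^{1,0}(Alb P_Γ)` for the simple CM isogeny factor
`B(Ψ)` of `A_{(K,Ψ)}` and the restriction of `σ` to its centre `K₁` (Poincaré reducibility; `H¹(X) = H¹(Alb X)`;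
`Hom(B, B') = 0` for non-isogenous simple `B, B'`); distinct blocks are in direct sum, equal data give equal
pieces — whence `UisoDisjoint`.  `Homogeneous` [P-IF]: a theta class `θ(φ,χ')` with splitting character `μ` lies
in the `ω(μ,ε,χ')`-isotypic part of `H¹_{B,ι₁}`, which is `Hom_E(A_K, A_μ)^* α` ([Liu21] Thm 4.18 and its proof,
chunk p0022 L72–p0023 L14; reading R1/R2/R4 of `ThetaModel.Fact_thetaAlbanese`), inside ONE block.  `ThetaOfLine` is a
DESIGN statement about the free primitive `T.Theta` ("the slot-`i` theta one-forms of a good context at level `Γ`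
include every holomorphic theta one-form class from its `i`-th line that lies in `U_{Ψ_i}(Γ)`"); with the
minimal reading `Theta V c i Γ := line Γ (c.D.a i) ∩ U_{c.Ψ i}` it and `Open_thetaSub` hold by definition.

## Headline theorems (gen 7 forms; names of run 28 reused verbatim otherwise)

`ThetaModel.thetaSpan_of_bmm`; packages `BMMFace` / `BMMPerL` (under the face / PerL binders ONLY: `d ≥ 3`,
`V` anisotropic — never `∀ X : BMMSpectrum, X.Cor79`, which is junk-false), `ContextGlueFace` / `ContextGluePerL`
((CG) verbatim, the other half of gen 6's residual — a hypothesis in Parts B–C, REDUCED in Part D below); `thetaSpanFace_of_bmm`,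
`thetaSpanPerL_of_bmm`; `COR_CM_of_liu_bmm : … → U.HC_CM`, `perL44_of_liu_bmm : … → U.PerL44`,
`perL_of_liu_bmm : … → U.PerL` (= run 28's `COR_CM_of_liu_thetaSpan` / `perL44_of_liu_thetaSpan` /
`perL_of_liu_thetaSpan` with `ThetaSpanFace`/`PerL` replaced by `BMMFace`/`PerL` ∧ `ContextGlueFace`/`PerL` and the
two DESIGN facts `Design_kappaConj`, `Design_frameSignConj`); and the PRINT-FACING END STATES
`COR_CM_of_liu_bmmMatch` / `perL44_of_liu_bmmMatch` / `perL_of_liu_bmmMatch` over `BMMMatchFace` / `BMMMatchPerL`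
(`SignForcing` replaced by `TypeMatch ∧ SignMatch`; `bmmFace_of_match`, `bmmPerL_of_match`).  Part A (`StubTree.SeesawDatum.swap01`,
`exists_seesawDatum_of_signs_fix1`, `exists_seesawDatum_of_signs_fix`) is pure KERNEL number theory: PerL Def 3.2's
four lines with the forced signs AND ONE OF THE FIRST TWO LINES PRESCRIBED (proof = `exists_seesawDatum_of_signs` of
`HodgeCM/Proofs/SeesawConstruction.lean` verbatim after the choice of `e₁`, plus the swap of the first two lines).

## Part D (v4) — the other half of generation 6's residual, (CG) `ContextGlue`, REDUCED as well

(CG) for `(K, Ψ, σ)` at `(L, ι₁, V)`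
    ⇐  [P-IF]   `T.Open_thetaSub` at `V` (theta one-forms of slot `i` lie in `U_{Ψ_i}`; in the tree a consequence of
                [Liu21] Thm 4.18: `ThetaModel.open_thetaSub_of_liu`, and ALREADY a binder `h₅` of every headline);
     ∧ [DESIGN] `BD.ThetaOfLine T` (as above) ∧ `BD.LineOfTheta T` (the converse reading: slot-`i` theta one-forms
                of a good context COME FROM its `i`-th line; together: `Θ_i(c, Γ) = line(Γ, a_i) ∩ U_{Ψ_i}(Γ)`, the
                "intended model" sentence of (CG)'s own docstring);
     ∧ KERNEL   `StubTree.SeesawDatum.exists_glue`: two seesaw data whose second lines have the same signs glue to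
                one with the first line of the first and the second line of the second (fourth line `a₃ b₁ / a₁`;
                equal signatures and discriminant classes, then LANDHERR — both directions PROVED in this package with
                no hypothesis: `HodgeCM.lemma33bLandherr_holds`, `HodgeCM.lemma33bLandherr_converse`), and the glued
                context is good (same `j` by injectivity of `ι₁`, forced signs carried over):
                `ThetaModel.contextGlue_of_bmm`.
So NEITHER half of generation 6's residual survives as a hypothesis of the FULLY DISCHARGED END STATES
`COR_CM_of_liu_bmmGlue : … → U.HC_CM`, `perL44_of_liu_bmmGlue : … → U.PerL44`, `perL_of_liu_bmmGlue : … → U.PerL`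
over the packages `BMMGlueFace` / `BMMGluePerL` (= `BMMMatchFace`/`PerL` ∧ `LineOfTheta`; `thetaSpanFace_of_bmmGlue`,
`thetaSpanPerL_of_bmmGlue`): every binder is P (by name) / P-IF / MODEL / DESIGN, plus the theta model's isolation
inputs, the datum package, Pohlmann and [QW8]+Milne exactly as in run 28's headline.

ABSOLUTE RULE respected: no internally-minted statement is cited as a fact; [BMM16] Cor 7.9 enters through its typed
verbatim statement; every other hypothesis is labelled P-IF / MODEL / DESIGN / THE OBSTRUCTION above and is a
hypothesis of the headline theorems, never an axiom.  Axioms of every theorem: `propext`, `Classical.choice`,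
`Quot.sound`.
-/

set_option autoImplicit false

noncomputable section

open scoped Matrix
open NumberField NumberField.InfinitePlace

namespace HodgeCM

open Literature.AlgebraicGeometry.Motives (CMType)
open Literature.AlgebraicGeometry.ShimuraVarieties (conjRingHomK embedding_conjRingHomK)

/-! ## Part A — KERNEL: Def 3.2's seesaw datum with one line prescribed -/

namespace StubTree.SeesawDatum

/-- Swapping the first two lines of a seesaw datum (`W₂ ⊕ W₁ ≅ W₁ ⊕ W₂ ≅ W₃ ⊕ W₄`: conjugate the isometry by the
permutation matrix). -/
def swap01 {L : CMField} (D : SeesawDatum L) : SeesawDatum L where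
  a := ![D.a 1, D.a 0, D.a 2, D.a 3]
  a_real i := by
    fin_cases i
    · exact D.a_real 1
    · exact D.a_real 0
    · exact D.a_real 2
    · exact D.a_real 3
  a_ne i := by
    fin_cases i
    · exact D.a_ne 1
    · exact D.a_ne 0
    · exact D.a_ne 2
    · exact D.a_ne 3
  iso := by
    obtain ⟨g, hg⟩ := D.iso
    let s : Matrix (Fin 2) (Fin 2) L := !![0, 1; 1, 0]
    have hs00 : s 0 0 = 0 := rfl
    have hs01 : s 0 1 = 1 := rfl
    have hs10 : s 1 0 = 1 := rfl
    have hs11 : s 1 1 = 0 := rfl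
    have hs : s * s = 1 := by
      ext i j
      fin_cases i <;> fin_cases j <;> simp [Matrix.mul_apply, Fin.sum_univ_two, hs00, hs01, hs10, hs11]
    have key : ∀ (x y : L) (M : Matrix (Fin 2) (Fin 2) L),
        ((s * M).transpose.map (conjRingHomK L)) * Matrix.diagonal ![x, y] * (s * M) =
          (M.transpose.map (conjRingHomK L)) * Matrix.diagonal ![y, x] * M := by
      intro x y M
      ext i j
      fin_cases i <;> fin_cases j <;>
        simp [Matrix.mul_apply, Fin.sum_univ_two, Matrix.diagonal, Matrix.transpose_apply, Matrix.map_apply,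
          hs00, hs01, hs10, hs11] <;>
        ring
    refine ⟨⟨s, s, hs, hs⟩ * g, ?_⟩
    show ((s * (g : Matrix (Fin 2) (Fin 2) L)).transpose.map (conjRingHomK L)) * Matrix.diagonal ![D.a 1, D.a 0] *
        (s * (g : Matrix (Fin 2) (Fin 2) L)) = Matrix.diagonal ![D.a 2, D.a 3]
    rw [key]
    exact hg

/-- (Ported verbatim from the HodgeCMPerL package; no docstring in the source.) -/
@[simp] theorem swap01_a_zero {L : CMField} (D : SeesawDatum L) : D.swap01.a 0 = D.a 1 := rfl
/-- (Ported verbatim from the HodgeCMPerL package; no docstring in the source.) -/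
@[simp] theorem swap01_a_one {L : CMField} (D : SeesawDatum L) : D.swap01.a 1 = D.a 0 := rfl
/-- (Ported verbatim from the HodgeCMPerL package; no docstring in the source.) -/
@[simp] theorem swap01_a_two {L : CMField} (D : SeesawDatum L) : D.swap01.a 2 = D.a 2 := rfl
/-- (Ported verbatim from the HodgeCMPerL package; no docstring in the source.) -/
@[simp] theorem swap01_a_three {L : CMField} (D : SeesawDatum L) : D.swap01.a 3 = D.a 3 := rfl

end StubTree.SeesawDatum

/-- **PerL Def 3.2 with the forced signs, the SECOND line prescribed** (KERNEL).  Given sign patterns `P₀,…,P₃` on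
the real places satisfying Lemma 3.3(b)'s pair condition and a conjugation-fixed `e₁ ≠ 0` with the signs `P₁`, there
are four conjugation-fixed non-zero `a_i` with the signs `P_i`, `a₁ = e₁`, and `W₁ ⊕ W₂ ≅ W₃ ⊕ W₄`.  Proof: the
construction `HodgeCM.exists_seesawDatum_of_signs` (`a₀ := e₀ t`, `a₁ := e₁`, `a₂ := a₀ + a₁`, `a₃ := a₀a₁a₂⁻¹`)
verbatim, with the given `e₁` in place of the chosen one. -/
theorem exists_seesawDatum_of_signs_fix1 (L : CMField) (P : Fin 4 → InfinitePlace L → Bool)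
    (hpair : ∀ w, ({P 0 w, P 1 w} : Multiset Bool) = {P 2 w, P 3 w})
    (e₁ : L) (he₁ : conjRingHomK L e₁ = e₁)
    (h1 : ∀ τ : L →+* ℂ, ∃ r : ℝ, τ e₁ = r ∧ r ≠ 0 ∧ (0 < r ↔ P 1 (InfinitePlace.mk τ) = true)) :
    ∃ D : StubTree.SeesawDatum L, D.a 1 = e₁ ∧
      ∀ (i : Fin 4) (τ : L →+* ℂ), (0 < (τ (D.a i)).re ↔ P i (InfinitePlace.mk τ) = true) := by
  classical
  obtain ⟨ι₁⟩ : Nonempty (L →+* ℂ) := inferInstance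
  have hpar : ∀ w, ((P 0 w = true ↔ (P 1 w = true ↔ P 2 w = true)) ↔ P 3 w = true) :=
    fun w => bool_pair_parity _ _ _ _ (hpair w)
  -- `e₀` with the required signs
  obtain ⟨e₀, he₀, h0⟩ := exists_isReal_signs L (P 0)
  have he₀0 : e₀ ≠ 0 := by
    obtain ⟨r, hr, hr0, -⟩ := h0 ι₁; exact Universe.ThetaModel.ne_zero_of_embedding ι₁ hr hr0
  have he₁0 : e₁ ≠ 0 := by
    obtain ⟨r, hr, hr0, -⟩ := h1 ι₁; exact Universe.ThetaModel.ne_zero_of_embedding ι₁ hr hr0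
  -- thresholds `|e₁/e₀|_w` and the set of places where `a₂` must follow the sign of `a₀` against that of `a₁`
  let C : InfinitePlace L → ℝ := fun w => w (e₁ * e₀⁻¹)
  have hC : ∀ w, 0 < C w := fun w => InfinitePlace.pos_iff.mpr (mul_ne_zero he₁0 (inv_ne_zero he₀0))
  let B : Finset (InfinitePlace L) := Finset.univ.filter fun w => P 0 w ≠ P 1 w ∧ P 2 w = P 0 w
  obtain ⟨t, ht, hT⟩ := exists_totallyPositive_magnitudes L B C hC
  -- the sign of `a₂ = e₀ t + e₁` at every embedding
  have hA2 : ∀ τ : L →+* ℂ, ∃ s : ℝ, τ (e₀ * t + e₁) = s ∧ s ≠ 0 ∧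
      (0 < s ↔ P 2 (InfinitePlace.mk τ) = true) := by
    intro τ
    obtain ⟨r₀, hr₀, hr₀0, i0⟩ := h0 τ
    obtain ⟨r₁, hr₁, hr₁0, i1⟩ := h1 τ
    obtain ⟨hρ, hρpos, hbig, hsmall⟩ := hT τ
    set ρ : ℝ := (τ t).re
    have hCτ : C (InfinitePlace.mk τ) = |r₁| / |r₀| := by
      show (InfinitePlace.mk τ) (e₁ * e₀⁻¹) = |r₁| / |r₀|
      rw [InfinitePlace.apply, map_mul, map_inv₀, hr₀, hr₁, norm_mul, norm_inv, Complex.norm_real,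
        Complex.norm_real, Real.norm_eq_abs, Real.norm_eq_abs, div_eq_mul_inv]
    have hr₀abs : 0 < |r₀| := abs_pos.mpr hr₀0
    refine ⟨r₀ * ρ + r₁, by rw [map_add, map_mul, hr₀, hr₁, hρ]; push_cast; ring, ?_⟩
    by_cases h01 : P 0 (InfinitePlace.mk τ) = P 1 (InfinitePlace.mk τ)
    · -- same signs: `a₂` has the common sign, which is the required one
      have h2 : P 2 (InfinitePlace.mk τ) = P 0 (InfinitePlace.mk τ) :=
        bool_pair_eq_left _ _ _ (by have h := hpair (InfinitePlace.mk τ); rw [← h01] at h; exact h)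
      have hs := sign_add_of_same hρpos hr₀0 hr₁0 (by rw [i0, i1, h01])
      exact ⟨hs.1, by rw [hs.2, i0, h2]⟩
    · by_cases h20 : P 2 (InfinitePlace.mk τ) = P 0 (InfinitePlace.mk τ)
      · -- `a₂` must follow `a₀`: `t > |e₁/e₀|` here
        have hmem : InfinitePlace.mk τ ∈ B := by
          simp only [B, Finset.mem_filter, Finset.mem_univ, true_and]; exact ⟨h01, h20⟩
        have hlt : |r₁| < |r₀| * ρ := by
          have h := hbig hmem; rw [hCτ] at h
          rwa [div_lt_iff₀ hr₀abs, mul_comm] at h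
        have hs := sign_add_of_dominant hr₀0 hlt
        exact ⟨hs.1, by rw [hs.2, i0, h20]⟩
      · -- `a₂` must follow `a₁`: `t < |e₁/e₀|` here
        have hnot : InfinitePlace.mk τ ∉ B := by
          simp only [B, Finset.mem_filter, Finset.mem_univ, true_and, not_and]; exact fun _ => h20
        have hlt : |r₀| * ρ < |r₁| := by
          have h := hsmall hnot; rw [hCτ] at h
          rwa [lt_div_iff₀ hr₀abs, mul_comm] at h
        have hs := sign_add_of_subordinate hρpos hr₁0 hlt
        have h21 : P 2 (InfinitePlace.mk τ) = P 1 (InfinitePlace.mk τ) := by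
          revert h01 h20
          cases P 0 (InfinitePlace.mk τ) <;> cases P 1 (InfinitePlace.mk τ) <;>
            cases P 2 (InfinitePlace.mk τ) <;> simp
        exact ⟨hs.1, by rw [hs.2, i1, h21]⟩
  have he2 : e₀ * t + e₁ ≠ 0 := by
    obtain ⟨s, hs, hs0, -⟩ := hA2 ι₁; exact Universe.ThetaModel.ne_zero_of_embedding ι₁ hs hs0
  have ht0 : t ≠ 0 := by
    obtain ⟨hρ, hρpos, -, -⟩ := hT ι₁; exact Universe.ThetaModel.ne_zero_of_embedding ι₁ hρ hρpos.ne'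
  -- the four lines
  let a : Fin 4 → L := ![e₀ * t, e₁, e₀ * t + e₁, e₀ * t * e₁ * (e₀ * t + e₁)⁻¹]
  have ha : ∀ i, conjRingHomK L (a i) = a i := by
    intro i
    fin_cases i
    · show conjRingHomK L (e₀ * t) = e₀ * t
      rw [map_mul, he₀, ht]
    · exact he₁
    · show conjRingHomK L (e₀ * t + e₁) = e₀ * t + e₁
      rw [map_add, map_mul, he₀, ht, he₁]
    · show conjRingHomK L (e₀ * t * e₁ * (e₀ * t + e₁)⁻¹) = e₀ * t * e₁ * (e₀ * t + e₁)⁻¹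
      rw [map_mul, map_mul, map_mul, map_inv₀, map_add, map_mul, he₀, ht, he₁]
  have ha0 : ∀ i, a i ≠ 0 := by
    intro i
    fin_cases i
    · exact mul_ne_zero he₀0 ht0
    · exact he₁0
    · exact he2
    · exact mul_ne_zero (mul_ne_zero (mul_ne_zero he₀0 ht0) he₁0) (inv_ne_zero he2)
  have hz : a 0 * a 1 = a 2 * a 3 * (1 * conjRingHomK L 1) := by
    show e₀ * t * e₁ = (e₀ * t + e₁) * (e₀ * t * e₁ * (e₀ * t + e₁)⁻¹) * (1 * conjRingHomK L 1)
    rw [map_one, mul_one, mul_one]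
    field_simp
  have hrep : a 0 * (1 * conjRingHomK L 1) + a 1 * (1 * conjRingHomK L 1) = a 2 := by
    show e₀ * t * (1 * conjRingHomK L 1) + e₁ * (1 * conjRingHomK L 1) = e₀ * t + e₁
    rw [map_one, mul_one, mul_one, mul_one]
  obtain ⟨g, hg⟩ := Lemma33bLandherrProof.isometry_of_rep L a ha ha0 1 one_ne_zero hz 1 1 hrep
  refine ⟨⟨a, ha, ha0, ⟨g, hg⟩⟩, rfl, fun i τ => ?_⟩
  -- the forced signs
  obtain ⟨r₀, hr₀, hr₀0, i0⟩ := h0 τ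
  obtain ⟨r₁, hr₁, hr₁0, i1⟩ := h1 τ
  obtain ⟨s, hs, hs0, i2⟩ := hA2 τ
  obtain ⟨hρ, hρpos, -, -⟩ := hT τ
  fin_cases i
  · show 0 < (τ (e₀ * t)).re ↔ P 0 (InfinitePlace.mk τ) = true
    rw [map_mul, hr₀, hρ, ← Complex.ofReal_mul, Complex.ofReal_re, ← i0]
    exact mul_pos_iff_of_pos_right hρpos
  · show 0 < (τ e₁).re ↔ P 1 (InfinitePlace.mk τ) = true
    rw [hr₁, Complex.ofReal_re]; exact i1
  · show 0 < (τ (e₀ * t + e₁)).re ↔ P 2 (InfinitePlace.mk τ) = true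
    rw [hs, Complex.ofReal_re]; exact i2
  · show 0 < (τ (e₀ * t * e₁ * (e₀ * t + e₁)⁻¹)).re ↔ P 3 (InfinitePlace.mk τ) = true
    have e3 : τ (e₀ * t * e₁ * (e₀ * t + e₁)⁻¹) = ((r₀ * (τ t).re * r₁ / s : ℝ) : ℂ) := by
      rw [map_mul, map_mul, map_inv₀, hs, map_mul, hr₀, hr₁, hρ, Complex.ofReal_re]; push_cast; ring
    have hx0 : r₀ * (τ t).re ≠ 0 := mul_ne_zero hr₀0 hρpos.ne'
    have hx : 0 < r₀ * (τ t).re ↔ 0 < r₀ := mul_pos_iff_of_pos_right hρpos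
    rw [e3, Complex.ofReal_re, pos_mul_div_iff hx0 hr₁0 hs0, hx, i0, i1, i2]
    exact hpar (InfinitePlace.mk τ)


-- port_pkg: scope closed for this part
end HodgeCM
end
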